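import Literature.NumberTheory.EllipticCurves.CongruenceNumberLevelBoundAsymptoticProofs
import HarnessLib

/-!
# The modular method's rung `EpsShapeBound 1` from modularity and Mazur–Kenku alone; Murty–Pasten
# 2013 Thm 7.1 (asymptotic clauses) and Pasten 2024 Thm 7.2 / 7.5 (`D = 1`) from named facts (proofs)

Topic `Literature/NumberTheory/EllipticCurves` (family `abc`, LADDER-ABC A1, the *modular method*;
cell abc-stewartyu, seat lit-abc-pasten g2). Theorems only — NO new statement, NO new named fact
(D-0026); sequel of `CongruenceNumberLevelBoundAsymptoticProofs.lean` (which DISCHARGED Murty–Pasten's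
Thm 4.3, asymptotic clause: `Σ_{P ≠ 𝕀_f} log η_f(P) ≤ (1/6) N log N + K N log log N` from Sturm's
bound, the trivial Hecke bound and the Atkin–Lehner/genus count —
`MurtyPasten.exists_sum_log_heckeCongruenceModulus_le`). Sources: M. R. Murty, H. Pasten, *Modular
forms and effective Diophantine approximation*, J. Number Theory **133** (2013) 3739–3754
[`MurtyPasten2013`], Thm 7.1 (p. 3752, second part: *"`h_F(E) < (1/12) N log N + O(N log log N)` and
`log|Δ_E| < N log N + O(N log log N)`"*) and §8 (Frey curves); H. Pasten, *Shimura curves and the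
abc conjecture*, J. Number Theory **254** (2024) = arXiv:1705.09251 [`PastenShimura2024`], §3
(3.1)–(3.2), Thm 5.5, Thm 7.2 and its proof (p. 26), Thm 7.5 (§7.4, p. 27).

## What this file proves

* `MurtyPasten.height_discriminant_asymptotic_of_modularity_mazurKenku` — Murty–Pasten Thm 7.1
  (asymptotic clauses; the named fact `MurtyPasten.height_discriminant_asymptotic` of
  `CongruenceNumberLevelBound.lean`) from TWO named facts: modularity with an integral Manin constant
  (`nonempty_modularParametrizationData`) and the Mazur–Kenku comparison
  (`PastenShimura2024_minimalDegree_le_163_mul`); via the tree's (EqHDeg)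
  `faltingsHeight_le_of_class_bound` and (EqDiscH) `log_minimalDiscriminantNorm_le_of_modularity'`.
  (The earlier `MurtyPasten.height_discriminant_asymptotic_of_pasten` needed Pasten's Thm 7.5 in both
  halves, i.e. Murty's Lemma 11 or Murty–Sinha on top of these two.)
* `epsShapeBound_one_of_discriminant_levelBound` — any bound `log|Δ_min(E)| ≤ A · N_E log N_E` for
  all `E/ℚ` with `N_E ≥ N₀` gives `Literature.Barriers.ABC.EpsShapeBound 1` (Frey curves, the proof of
  `epsShapeBound_one_of_pasten_thm_7_5` with the constant made a parameter); whence
  **`epsShapeBound_one_of_modularity_mazurKenku`** and `epsShapeBound_one_of_exists_isNewformOf_mazurKenku`: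
  the modular method's rung A1.P (`EpsShapeBound 1`, = A1.M2⁻) with trust base EXACTLY
  {Modularity Theorem, Mazur–Kenku} — no Deligne, no Murty Lemma 11, no Murty–Sinha, no Thm 7.2 fact
  (compare `epsShapeBound_one_of_modularity_of_thm_7_2`, three facts).
* Corollaries for the named fact `PastenShimura2024_thm_7_2_asymptotic` (`D = 1`):
  `PastenShimura2024_thm_7_2_asymptotic_of_murtySinha` (from the single named fact
  `murtySinha2009_eigenvalue_multiplicity_weightTwo`, by `Pasten2024.exists_log_modularDegree_lt_of_murtySinha_only`),
  `PastenShimura2024_thm_7_2_asymptotic_of_deligne_murty` (the printed road: Thm 5.5, Deligne's bound,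
  Murty's Lemma 11 `murty1999_lemma11_distinguishingIndex`, Prop 7.1), and
  `PastenShimura2024_thm_7_5_height_of_modularity_mazurKenku_murtySinha`.

WHAT THIS IS NOT: no claim on `abc`; `θ₀ = 1` rungs are weaker than the REACHED `EpsShapeBound (2/3)`
(Stewart–Yu 1991) and do not touch the `1/3` record; the constants are not Murty–Pasten's (their
`O`-constant is not printed).

## References

* [MurtyPasten2013] M. R. Murty, H. Pasten, J. Number Theory 133 (2013) 3739–3754: Thm 4.3
  (p. 3748), Prop. 6.3, Thm 7.1 (pp. 3751–3752), §8.
* [PastenShimura2024] H. Pasten, J. Number Theory 254 (2024) 214–335 = arXiv:1705.09251: §3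
  (3.1)–(3.2) p. 13, Thm 5.5 (p. 18), Thm 7.2 and its proof (p. 26), Thm 7.5 (p. 27).
* [MurtySinha2009] M. R. Murty, K. Sinha, J. Number Theory 129 (2009), eq. (1) p. 683.
* [Murty1999CongruencePrimes] M. R. Murty, Proc. Sympos. Pure Math. 66.1 (1999), §6 Lemma 11.
* [BCDTJAMS2001] C. Breuil, B. Conrad, F. Diamond, R. Taylor, J. Amer. Math. Soc. 14 (2001), Thm. A.
-/

noncomputable section

open scoped MatrixGroups ModularForm

open WeierstrassCurve CongruenceSubgroup UpperHalfPlane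

namespace Literature.NumberTheory.EllipticCurves

open ModularForms Pasten2024 DiophantineGeometry

namespace MurtyPasten

/-! ### Real-arithmetic bookkeeping -/

/-- `log log N ≥ 1` for `N ≥ 16` (`log 16 = 4 log 2 > 2.77 > e`). [folklore] -/
private theorem one_le_log_log {N : ℕ} (hN : 16 ≤ N) : 1 ≤ Real.log (Real.log (N : ℝ)) := by
  have hN' : (16 : ℝ) ≤ N := by exact_mod_cast hN
  have hl2 := Real.log_two_gt_d9
  have he := Real.exp_one_lt_d9
  have h16 : Real.log 16 = 4 * Real.log 2 := by
    rw [show (16 : ℝ) = 2 ^ 4 by norm_num, Real.log_pow]; norm_num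
  have hlog16 : Real.log 16 ≤ Real.log N := Real.log_le_log (by norm_num) hN'
  have hlogN : 0 < Real.log (N : ℝ) := by linarith
  rw [Real.le_log_iff_exp_le hlogN]
  linarith

/-- `2 ≤ log N` for `N ≥ 16`. [folklore] -/
private theorem two_le_log {N : ℕ} (hN : 16 ≤ N) : 2 ≤ Real.log (N : ℝ) := by
  have hN' : (16 : ℝ) ≤ N := by exact_mod_cast hN
  have hl2 := Real.log_two_gt_d9
  have h16 : Real.log 16 = 4 * Real.log 2 := by
    rw [show (16 : ℝ) = 2 ^ 4 by norm_num, Real.log_pow]; norm_num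
  have hlog16 : Real.log 16 ≤ Real.log N := Real.log_le_log (by norm_num) hN'
  linarith

/-! ### Murty–Pasten 2013, Thm 7.1 (asymptotic clauses) from modularity and Mazur–Kenku -/

/-- `log 163 < 5.55` (`163 < 2⁸`). [folklore] -/
private theorem log_163_lt : Real.log 163 < 5.55 := by
  have h163 : Real.log 163 ≤ 8 * Real.log 2 := by
    rw [← Real.log_rpow (by norm_num), show ((2 : ℝ) ^ (8 : ℝ)) = 256 by norm_num]
    exact Real.log_le_log (by norm_num) (by norm_num)
  have hl2 := Real.log_two_lt_d9
  linarith

/-- **Murty–Pasten 2013, Theorem 7.1, asymptotic clauses, from modularity and Mazur–Kenku** (PROVED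
reduction of the named fact `MurtyPasten.height_discriminant_asymptotic` to TWO named facts):
`h_F(E) < (1/12) N log N + K N log log N` and `log|Δ_E| < N log N + K N log log N` for every elliptic
curve `E/ℚ` of conductor `N ≥ 16`, granted modularity with an integral Manin constant
(`nonempty_modularParametrizationData`) and the Mazur–Kenku comparison
(`PastenShimura2024_minimalDegree_le_163_mul`). Printed proof (p. 3752): Prop 6.3
(`h_F(E) ≤ ½ log m_f + O(1)`, in the tree (EqHDeg) `faltingsHeight_le_of_class_bound`: Zagier's
identity, the trivial Petersson bound, Mazur–Kenku), Thm 4.3 asymptotic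
(`exists_sum_log_heckeCongruenceModulus_le` with Thm 5.5), and Thm 5.4 / Silverman
(`log|Δ| ≤ 12 h + 16`, in the tree (EqDiscH) `log_minimalDiscriminantNorm_le_of_modularity'`), on a
global minimal model (`hasGlobalMinimalModel_rat_holds`; `h` and `Δ_min`, `N` are model-invariant).
[cite: MurtyPasten2013, Thm 7.1 (p. 3752, second part) with Prop. 6.3 and Thm 4.3] [cite: PastenShimura2024, §3 (3.1)–(3.2) p. 13] -/
theorem height_discriminant_asymptotic_of_modularity_mazurKenku
    (hmod : nonempty_modularParametrizationData) (h163 : PastenShimura2024_minimalDegree_le_163_mul) :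
    height_discriminant_asymptotic := by
  obtain ⟨K, hK0, hK⟩ := exists_sum_log_heckeCongruenceModulus_le
  refine ⟨6 * K + 12, 16, fun W _ hNW => ?_⟩
  -- a global minimal model `C • W` (same height, minimal discriminant and conductor)
  obtain ⟨C, hC⟩ := hasGlobalMinimalModel_rat_holds W
  haveI := hC
  have hN : (C • W).conductorNorm ℤ = W.conductorNorm ℤ := conductorNorm_smul_rat W C
  haveI : NeZero ((C • W).conductorNorm ℤ) := ⟨(conductorNorm_pos_holds (C • W)).ne'⟩
  rw [← faltingsHeight_smul W C, ← minimalDiscriminantNorm_smul_rat W C, ← hN]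
  have hN16 : 16 ≤ (C • W).conductorNorm ℤ := by rw [hN]; exact hNW
  set N : ℕ := (C • W).conductorNorm ℤ with hNdef
  have hL := two_le_log hN16
  have hM := one_le_log_log hN16
  have hN' : (16 : ℝ) ≤ N := by exact_mod_cast hN16
  set L : ℝ := Real.log N with hLdef
  set M : ℝ := Real.log L with hMdef
  -- the class bound `log δ₀ < B` at level `N` (Thm 5.5 + the size estimate)
  set B : ℝ := (1 / 6 : ℝ) * N * L + K * N * M + 1 with hBdef
  have hB : ∀ (W₀ : WeierstrassCurve ℚ) [W₀.IsElliptic] (D₀ : ModularParametrizationData W₀ N),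
      (∀ (W'' : WeierstrassCurve ℚ) [W''.IsElliptic] (D'' : ModularParametrizationData W'' N),
          D''.f = D₀.f → D₀.modularDegree ≤ D''.modularDegree) →
        Real.log (D₀.modularDegree : ℝ) < B := fun W₀ _ D₀ hmin => by
    have h1 := log_modularDegree_le_sum_log_heckeCongruenceModulus PastenShimura2024_thm_5_5_holds
      D₀ hmin
    have h2 := hK N W₀ D₀ hN16
    rw [hBdef]
    linarith
  -- (EqHDeg): the height
  have hh := faltingsHeight_le_of_class_bound hmod h163 (C • W) hB
  have hc := eqHDeg_const_lt
  -- (EqDiscH): the discriminant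
  have hΔ := log_minimalDiscriminantNorm_le_of_modularity' hmod (C • W)
  have hmd := log_minModularDegree_le_of_class_bound h163 (hmod (C • W)) hB
  have hl := log_163_lt
  have hNM : (16 : ℝ) ≤ (N : ℝ) * M := by nlinarith
  have hKNM : 0 ≤ K * ((N : ℝ) * M) := by positivity
  constructor
  · rw [hBdef] at hh
    nlinarith
  · rw [hBdef] at hmd
    nlinarith

end MurtyPasten

/-! ### `EpsShapeBound 1` from any `N log N`-shaped discriminant bound, and from two named facts -/

section EpsShape

open UniqueFactorizationMonoid IsDedekindDomain

/-- **`EpsShapeBound 1` from a bound `log|Δ_min(E)| ≤ A · N_E log N_E` (`N_E ≥ N₀`)** (PROVED; the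
Frey-curve translation of Murty–Pasten §8 with the constant a parameter): for every `ε > 0`,
`log c ≤ ((2 + 5632 A)/ε) · rad(abc)^{1+ε}` for all `abc` triples with `c ≥ c₀(ε)`. Proof as
`epsShapeBound_one_of_pasten_thm_7_5`: for the Frey model `W₀` of `exists_frey_model_sq_dvd`,
`2 log c ≤ 8 log 2 + log|Δ_min|`, `N ≤ 2¹⁰ rad(abc)`; the bound applies once `N ≥ N₀`, which holds
as soon as `abc` has a prime factor `p ≥ 2(N₀ + 2)` (it divides `Δ_min`, hence `N`:
`radical_conductorNorm_eq_holds`); the finitely many triples with all primes `< 2(N₀+2)` (Mahler,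
`finite_setOf_isABCTriple_primeFactors_subset_holds`) are excluded by `c₀`; then `log R ≤ R^ε/ε`.
[cite: MurtyPasten2013, §8 (proof of Thm 1.2)] [cite: PastenShimura2024, §3 (Frey–Hellegouarch curves)] -/
theorem epsShapeBound_one_of_discriminant_levelBound {A : ℝ} {N₀ : ℕ} (hA : 0 ≤ A)
    (h : ∀ (W : WeierstrassCurve ℚ) [W.IsElliptic], N₀ ≤ W.conductorNorm ℤ →
      Real.log (W.minimalDiscriminantNorm ℤ : ℝ) ≤
        A * (W.conductorNorm ℤ : ℝ) * Real.log (W.conductorNorm ℤ)) :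
    Literature.Barriers.ABC.EpsShapeBound 1 := by
  intro ε hε
  set M : ℕ := N₀ + 2 with hM
  -- Mahler: the triples all of whose primes are `< 2M` form a finite set; bound their `c`
  have hfin := finite_setOf_isABCTriple_primeFactors_subset_holds (Finset.range (2 * M))
  obtain ⟨B, hB⟩ := (hfin.image fun t : ℕ × ℕ × ℕ => t.2.2).bddAbove
  refine ⟨(2 + 5632 * A) / ε, (B : ℝ) + 1, fun a b c ht hc₀ => ?_⟩
  have ht' := ht
  obtain ⟨ha, hb, habc, hcop⟩ := ht'
  have hc : 0 < c := by omega
  -- a prime factor `p ≥ 2M` of `abc`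
  have hnot : ¬ (a * b * c).primeFactors ⊆ Finset.range (2 * M) := by
    intro hsub
    have hmem : c ∈ (fun t : ℕ × ℕ × ℕ => t.2.2) ''
        {t : ℕ × ℕ × ℕ | IsABCTriple t.1 t.2.1 t.2.2 ∧
          (t.1 * t.2.1 * t.2.2).primeFactors ⊆ Finset.range (2 * M)} :=
      ⟨(a, b, c), ⟨ht, hsub⟩, rfl⟩
    have h1 : c ≤ B := hB hmem
    have h2 : (c : ℝ) ≤ B := by exact_mod_cast h1
    linarith
  obtain ⟨p, hp, hpM⟩ := Finset.not_subset.mp hnot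
  have hpP : p.Prime := Nat.prime_of_mem_primeFactors hp
  have hpdvd : p ∣ a * b * c := Nat.dvd_of_mem_primeFactors hp
  have hp2M : 2 * M ≤ p := by simpa [Finset.mem_range] using hpM
  -- the Frey model and the discriminant bound at its conductor
  obtain ⟨W₀, hE, hN, hΔ⟩ := exists_frey_model_sq_dvd ht
  haveI := hE
  have hΔpos : 0 < (W₀.baseChange ℚ).minimalDiscriminantNorm ℤ := minimalDiscriminantNorm_pos_holds _
  have hNpos : 0 < (W₀.baseChange ℚ).conductorNorm ℤ := conductorNorm_pos_holds _
  have hp2 : p ≠ 2 := by omega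
  have hpΔ : p ∣ (W₀.baseChange ℚ).minimalDiscriminantNorm ℤ := by
    have h1 : p ∣ 2 ^ 8 * (W₀.baseChange ℚ).minimalDiscriminantNorm ℤ :=
      hpdvd.trans ((dvd_pow_self _ two_ne_zero).trans hΔ)
    have hcop2 : Nat.Coprime p (2 ^ 8) :=
      Nat.Coprime.pow_right 8 ((Nat.coprime_primes hpP Nat.prime_two).mpr hp2)
    exact hcop2.dvd_of_dvd_mul_left h1
  have hpN : p ∈ ((W₀.baseChange ℚ).conductorNorm ℤ).primeFactors := by
    have hrad := (W₀.baseChange ℚ).radical_conductorNorm_eq_holds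
    rw [natRadical_eq_iff] at hrad
    rw [hrad]
    exact Nat.mem_primeFactors.mpr ⟨hpP, hpΔ, hΔpos.ne'⟩
  have hNge : N₀ ≤ (W₀.baseChange ℚ).conductorNorm ℤ :=
    le_trans (by omega) (hp2M.trans (Nat.le_of_mem_primeFactors hpN))
  have hbound := h (W₀.baseChange ℚ) hNge
  -- real-number bookkeeping
  have hradpos : 0 < rad a b c := by rw [rad_def]; exact Nat.radical_pos _
  have hR2 : (2 : ℝ) ≤ (rad a b c : ℝ) := by exact_mod_cast IsABCTriple.two_le_rad ht
  have hN1 : (1 : ℝ) ≤ ((W₀.baseChange ℚ).conductorNorm ℤ : ℝ) := by exact_mod_cast hNpos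
  have hD0 : (0 : ℝ) < ((W₀.baseChange ℚ).minimalDiscriminantNorm ℤ : ℝ) := by exact_mod_cast hΔpos
  have hNR : ((W₀.baseChange ℚ).conductorNorm ℤ : ℝ) ≤ 1024 * (rad a b c : ℝ) := by
    have := Nat.le_of_dvd (mul_pos (by positivity) hradpos) hN
    exact_mod_cast this
  have hc2 : (c : ℝ) ^ 2 ≤ 2 ^ 8 * ((W₀.baseChange ℚ).minimalDiscriminantNorm ℤ : ℝ) := by
    have h1 : c ≤ a * b * c := Nat.le_mul_of_pos_left c (by positivity)
    have h2 : (a * b * c) ^ 2 ≤ 2 ^ 8 * (W₀.baseChange ℚ).minimalDiscriminantNorm ℤ :=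
      Nat.le_of_dvd (by positivity) hΔ
    have h3 : c ^ 2 ≤ 2 ^ 8 * (W₀.baseChange ℚ).minimalDiscriminantNorm ℤ :=
      (Nat.pow_le_pow_left h1 2).trans h2
    exact_mod_cast h3
  set N : ℝ := ((W₀.baseChange ℚ).conductorNorm ℤ : ℝ) with hNdef
  set D : ℝ := ((W₀.baseChange ℚ).minimalDiscriminantNorm ℤ : ℝ) with hDdef
  set R : ℝ := (rad a b c : ℝ) with hRdef
  have hl2 := Real.log_two_lt_d9
  have hl2' := Real.log_two_gt_d9
  have hlogc : 2 * Real.log c ≤ 8 * Real.log 2 + Real.log D := by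
    have h1 : Real.log ((c : ℝ) ^ 2) ≤ Real.log (2 ^ 8 * D) :=
      Real.log_le_log (by positivity) hc2
    rw [Real.log_pow, Real.log_mul (by positivity) hD0.ne', Real.log_pow] at h1
    push_cast at h1
    linarith
  have hL : Real.log 2 ≤ Real.log R := Real.log_le_log (by norm_num) hR2
  have hlogN0 : 0 ≤ Real.log N := Real.log_nonneg hN1
  have hlogN : Real.log N ≤ 10 * Real.log 2 + Real.log R := by
    have h1 : Real.log N ≤ Real.log (1024 * R) := Real.log_le_log (by linarith) hNR
    rw [Real.log_mul (by norm_num) (by linarith), show (1024 : ℝ) = 2 ^ 10 by norm_num,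
      Real.log_pow] at h1
    push_cast at h1
    linarith
  have hNlogN : N * Real.log N ≤ 1024 * R * (10 * Real.log 2 + Real.log R) :=
    mul_le_mul hNR hlogN hlogN0 (by positivity)
  -- with `X = R log R ≥ 2 log 2`: `log D ≤ 11264 A X`, `8 log 2 ≤ 4 X`, so `log c ≤ (2 + 5632 A) X`
  set X : ℝ := R * Real.log R with hXdef
  have hR0 : (0 : ℝ) < R := by linarith
  have hX : 2 * Real.log 2 ≤ X := by rw [hXdef]; exact mul_le_mul hR2 hL (by linarith) hR0.le
  have hl2R : Real.log 2 * R ≤ X := by rw [hXdef]; nlinarith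
  have hD1 : Real.log D ≤ A * (1024 * R * (10 * Real.log 2 + Real.log R)) :=
    hbound.trans (by rw [mul_assoc]; exact mul_le_mul_of_nonneg_left hNlogN hA)
  have hD2 : A * (1024 * R * (10 * Real.log 2 + Real.log R)) ≤ 11264 * A * X := by
    have : 1024 * R * (10 * Real.log 2 + Real.log R) = 10240 * (Real.log 2 * R) + 1024 * X := by
      rw [hXdef]; ring
    rw [this]
    nlinarith
  have hmain : Real.log c ≤ (2 + 5632 * A) * X := by nlinarith
  -- `log R ≤ R^ε / ε`
  have hlogR : Real.log R ≤ R ^ ε / ε := Real.log_le_rpow_div hR0.le hε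
  have hK0 : 0 ≤ 2 + 5632 * A := by positivity
  calc Real.log c ≤ (2 + 5632 * A) * (R * Real.log R) := hmain
    _ ≤ (2 + 5632 * A) * (R * (R ^ ε / ε)) := by gcongr
    _ = (2 + 5632 * A) / ε * (R ^ (1 : ℝ) * R ^ ε) := by rw [Real.rpow_one]; ring
    _ = (2 + 5632 * A) / ε * R ^ (1 + ε : ℝ) := by rw [← Real.rpow_add hR0]

/-- **Rung A1.P with trust base {Modularity, Mazur–Kenku}** (PROVED): `EpsShapeBound 1`
(`log c ≪_ε rad(abc)^{1+ε}`, the rung A1.M2⁻ `EpsShapeBoundOne`) follows from modularity with an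
integral Manin constant (`nonempty_modularParametrizationData`) and the Mazur–Kenku comparison
(`PastenShimura2024_minimalDegree_le_163_mul`) ALONE — the modular method end to end over the tree:
Murty–Pasten Thm 7.1 asymptotic (`height_discriminant_asymptotic_of_modularity_mazurKenku`:
`log|Δ_E| < N log N + K N log log N ≤ (1 + K) N log N`) and
`epsShapeBound_one_of_discriminant_levelBound`. Compare `epsShapeBound_one_of_modularity_of_thm_7_2`
(which needs the fact `PastenShimura2024_thm_7_2_asymptotic`, i.e. Deligne + Murty's Lemma 11, on top).
[cite: MurtyPasten2013, Thm 7.1 and §8] [cite: PastenShimura2024, Thm. 5.5 and §3] -/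
theorem epsShapeBound_one_of_modularity_mazurKenku (hmod : nonempty_modularParametrizationData)
    (h163 : PastenShimura2024_minimalDegree_le_163_mul) :
    Literature.Barriers.ABC.EpsShapeBound 1 := by
  obtain ⟨K, N₀, hK⟩ := MurtyPasten.height_discriminant_asymptotic_of_modularity_mazurKenku hmod h163
  refine epsShapeBound_one_of_discriminant_levelBound (A := 1 + max K 0) (N₀ := max N₀ 3)
    (by positivity) fun W _ hN => ?_
  have hN₀ : N₀ ≤ W.conductorNorm ℤ := le_trans (le_max_left _ _) hN
  have h3 : (3 : ℝ) ≤ (W.conductorNorm ℤ : ℝ) := by exact_mod_cast le_trans (le_max_right _ _) hN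
  have h := (hK W hN₀).2
  set N : ℝ := (W.conductorNorm ℤ : ℝ) with hNdef
  set L : ℝ := Real.log N with hLdef
  have hL1 : 1 ≤ L := by
    rw [hLdef, Real.le_log_iff_exp_le (by linarith)]
    have := Real.exp_one_lt_d9
    linarith
  have hML : Real.log L ≤ L := by
    have := Real.log_le_sub_one_of_pos (show 0 < L by linarith)
    linarith
  have hM0 : 0 ≤ Real.log L := Real.log_nonneg hL1
  have hKle : K ≤ max K 0 := le_max_left _ _
  have hKM : K * N * Real.log L ≤ max K 0 * N * L := by
    calc K * N * Real.log L ≤ max K 0 * N * Real.log L := by gcongr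
      _ ≤ max K 0 * N * L := by gcongr
  linarith

/-- **Rung A1.P from the Modularity Theorem "Version `a_p`" and Mazur–Kenku** (PROVED): as
`epsShapeBound_one_of_modularity_mazurKenku`, with the parametrisation datum obtained from
`exists_isNewformOf` (a newform `f ∈ S₂(Γ₀(N_E))` with `aₙ(f) = aₙ(E)`; BCDT) through the tree's
`nonempty_modularParametrizationData_of_modularity` and the discharged
`IsNewformOf.exists_maninConstant_modularDegree_holds`.
[cite: MurtyPasten2013, Thm 7.1 and §8] [cite: BCDTJAMS2001, Thm. A] -/
theorem epsShapeBound_one_of_exists_isNewformOf_mazurKenku (h₁ : exists_isNewformOf)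
    (h163 : PastenShimura2024_minimalDegree_le_163_mul) :
    Literature.Barriers.ABC.EpsShapeBound 1 :=
  epsShapeBound_one_of_modularity_mazurKenku
    (nonempty_modularParametrizationData_of_modularity h₁
      IsNewformOf.exists_maninConstant_modularDegree_holds) h163

end EpsShape

/-! ### Pasten's Thm 7.2 (asymptotic, `D = 1`) and Thm 7.5 (height) from named facts -/

/-- **Pasten 2024, Thm 7.2 (asymptotic clause, `D = 1`) from Murty–Sinha's multiplicity bound alone**
(PROVED reduction of the named fact `PastenShimura2024_thm_7_2_asymptotic` to ONE named fact,
`murtySinha2009_eigenvalue_multiplicity_weightTwo`, itself reduced in the tree to prime-power instances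
of the Eichler–Selberg trace formula): `Pasten2024.exists_log_modularDegree_lt_of_murtySinha_only`
(congruence splitting at one good prime, trivial Hecke bounds, Prop 7.1, Mertens, Chebyshev) gives
`log δ_{1,N} < (1/24 + ε) N log N` — indeed `o(N log N)` — for `N ≫_ε 1`.
[cite: PastenShimura2024, Thm. 7.2 (asymptotic clause, p. 26)] [cite: MurtySinha2009, eq. (1) p. 683] -/
theorem PastenShimura2024_thm_7_2_asymptotic_of_murtySinha
    (hMS : murtySinha2009_eigenvalue_multiplicity_weightTwo) :
    PastenShimura2024_thm_7_2_asymptotic := fun _ hε =>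
  Pasten2024.exists_log_modularDegree_lt_of_murtySinha_only hMS hε

/-- **Pasten 2024, Thm 7.2 (asymptotic clause, `D = 1`) along the printed road** (PROVED reduction
to two named facts): Thm 5.5 (`PastenShimura2024_thm_5_5_holds`, PROVED), Deligne's bound in weight
`2` (`Deligne1974_heckeT_eigenvalue_norm_le`), Murty's Lemma 11 (`murty1999_lemma11_distinguishingIndex`,
"`n_c ≪_ε N^{1+ε}`") and Prop 7.1 (`Pasten2024.exists_sum_erase_finrank_quotient_le`, PROVED), via
`Pasten2024.log_modularDegree_lt_of_thm_5_5_asymptotic'`.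
[cite: PastenShimura2024, Thm. 7.2 (asymptotic clause) and its proof, p. 26] [cite: Murty1999CongruencePrimes, §6 Lemma 11] -/
theorem PastenShimura2024_thm_7_2_asymptotic_of_deligne_murty
    (hDel : Deligne1974_heckeT_eigenvalue_norm_le) (hMurty : murty1999_lemma11_distinguishingIndex) :
    PastenShimura2024_thm_7_2_asymptotic := fun _ hε =>
  Pasten2024.log_modularDegree_lt_of_thm_5_5_asymptotic' PastenShimura2024_thm_5_5_holds
    hDel.weight_two hMurty (fun _ hκ => Pasten2024.exists_sum_erase_finrank_quotient_le hκ) hε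

/-- **Pasten 2024, Thm 7.5, asymptotic height clause `h(E) < (1/48 + ε) N log N`, from modularity,
Mazur–Kenku and Murty–Sinha** (PROVED reduction to three named facts:
`PastenShimura2024_thm_7_5_height_of_thm_7_2` with `PastenShimura2024_thm_7_2_asymptotic_of_murtySinha`).
[cite: PastenShimura2024, Thm 7.5 (proof, §7.4 p. 27)] -/
theorem PastenShimura2024_thm_7_5_height_of_modularity_mazurKenku_murtySinha
    (hmod : nonempty_modularParametrizationData) (h163 : PastenShimura2024_minimalDegree_le_163_mul)
    (hMS : murtySinha2009_eigenvalue_multiplicity_weightTwo) : PastenShimura2024_thm_7_5_height :=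
  PastenShimura2024_thm_7_5_height_of_thm_7_2 hmod h163
    (PastenShimura2024_thm_7_2_asymptotic_of_murtySinha hMS)

end Literature.NumberTheory.EllipticCurves

end
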